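import Summits.QuantumFields.BalabanUV.T4Continuum.Support.LateMergersSpan

/-!
# Balaban T⁴ spine, estimate NE7b (node U5c, COUNT member P1): LATE MERGERS WITH AN OVERDUE PARTNER under [CONV-D]
# — part 3 of 4: the late-merger data inhabit `T4BankedInduction.Banking` over the padded lives; ONE infrared threshold

Cell `pub-balaban`, lineage `b2b-balaban-t4-ne7b-p1` (generation 17), self-row `T4-U5c.E-NE7b-LATEMERGE-K*`, residual
(H1) of GAPS G-ne7bp1g16-1; Summits-side NEW WORK under the LEAN PLACEMENT RULE 2026-08-19 (cell bookkeeping, print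
quoted for CONTEXT only); same namespace as parts 1–2; imports part 2 (`…Support.LateMergersSpan`) ONLY.

HONEST FRAMING.  Rung (B)+1 of the FINITE-VOLUME T⁴ continuum programme: bookkeeping over the lineage's OWN typed
ledger of persistent large-field histories (`T4PersistenceDictionary.Gen`, `T4TaggedShapeBanking`, `T4CountHorizon`).
NOT infinite volume, NOT a mass gap, NOT the Clay problem, NOT a proof of NE7b; nothing of Bałaban's expansion is
asserted; `BetaPertH` / (B) / (B^μ) are not involved (upstream of the term families, displayed by name elsewhere).
HONEST DEPENDENCY (cell, verbatim): continuum YM on T⁴ ⇐ BetaPertH ∧ nine spine estimates (0/9 proved); BetaPertH ⇐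
(D1) ∧ (D4) ∧ CAP+tail; G-an2-4 gates asym, D1 and NE2/3/4.

CONTENT (part 3; every declaration [folklore], sorry-free, standard axioms).  §7 The four binders of `Banking
(ConsistentTH sh C K R D) (padW (dictWT sh R C.n₁) D) (costT sh C K R) (credit C g ∘ sh) (κ₁·bankW + Emarg)
(reserve C g ∘ sh) (extnT sh C K R)`: BIRTH `bornTH_holds` and RENEWAL `renewTH_holds` / `renewTH_past_eq` are
`T4TaggedShapeBanking.bornT_holds` / `renewT_holds` / `renewT_past_eq` BY NAME (a born / renewed structure ends by the
horizon, so it IS `ConsistentT`; its cost vanishes on the padding `[reach, reach + D)` of its window — the pay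
inequalities `Hb`, `Hr` are VERBATIM those of `T4TaggedShapeBanking`); MERGER GEOMETRY `lifeCostTH_merge_eq` EXACT over
the padded lives (additivity over disjoint label sets; the merger's true window `[M, M + W e)` and connector epoch lie
in the merged padded life because an overdue partner has `reach + D > t`); MERGER PAY `mergeTH_pay_holds` at the
ABSORBED ROOT with the horizon in the bank: `2p₀(g_m)` pays the true extension and `κ₁(n₁ + R_t + D) + E₀`, given the
displayed inequality `HmH m : ((n₁ + L)E₂L^{q′} + dC·E₃·L^{q′}L^{q′})·R_m^{q′+1} + (κ₁(n₁ + D + L·R_m) + E₀) ≤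
2p₀(g_m)` (`R_t ≤ L·R_m` by (2.9)-shape `FlowIneq29` when `m < t`); assembled `banking_lateMergers`.  §8
`mergePayH_of_flow` = `T4BankedInduction.mergeSurplus_pays` with window profile `n₁ + D + L·R_s`;
`exists_payThresholdH` / `exists_irThresholdTH`: ONE `x₀`, depending on the symbolic constants and on `D` — NOT on the
cutoff `K` — beyond which, along EVERY run of the typed flow ((2.7) `B14.FlowIneq27`, (2.9) `FlowIneq29`, (2.5)
`B14.IsRj`, `1 ≤ log g_s⁻²`), the late-merger data of EVERY shape map `sh : ε → PEv` inhabit `Banking`.  (Residual (H2)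
of G-ne7bp1g16-2 — un-booked overdue floors — is NOT addressed here; it is a further K-free raise of the same `x₀`.)

ABSOLUTE RULE.  No internally-minted statement enters as a cited fact: 0 `[cite:]` tags, every hypothesis of every
theorem is a displayed binder; the manuscripts under audit (B15 = [Balaban1989LargeFieldI], B16 =
[Balaban1989LargeFieldII]; (1.79)–(1.89) pp. 383–387, (2.5)/(2.7)/(2.9) p. 361 of B14 = [Balaban1988RenormLattice])
appear in docstrings as CONTEXT only, never as facts; programme-internal claims are not cited.  NOT PRINTED: [CONV-D],
the ledger, the banks and every inequality here are the cell's MODEL of print's procedure, handed to the (ID) owner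
(GAPS G-ne7bp1g9-1) as the target of an identification nobody in the cell asserts.
-/

namespace Summit.QuantumFields.BalabanUV.T4Continuum.LateMergers

open Finset
open Literature.MathematicalPhysics.QuantumFieldTheory.Balaban1983to89
open T4PersistenceDictionary T4PersistentHistoryCount T4BankedInduction T4PrintedShapeBanking
open T4WeightBudget T4GlobalDenominator T4LiveClassFibration T4LiveStructureGas T4LiveGasToTerms T4RecordPriceSeam
open T4PartnerMultiplicity T4BranchingRecordsGas T4TaggedShapeBanking T4CanonicalMenus T4CountHorizon

noncomputable section

/-! ## §7 The late-merger data inhabit `Banking` over the padded lives, with the merger-padded bank -/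

section InhabitTH

variable {ε : Type*} [DecidableEq ε] {sh : ε → PEv} {C : T4PrintedShapeBanking.Consts} {K L : ℕ} {R : ℕ → ℕ}
  {D : ℕ} {g : ℕ → ℝ} {β' β₀ : ℝ}

/-- **BIRTH**: over the padded window `[j, j + W b + D)` a consistent bare region books exactly what it books over
`[j, j + W b)` (its cost vanishes from its true reach on), its bank is its true window — `bornT_holds` by name.
[folklore] -/
theorem bornTH_holds (hC : C.Valid) (h29 : B14FlowStep.FlowIneq29 R g L β' β₀ K) (hL : 1 ≤ L)
    (hR1 : ∀ s, s ≤ K → 1 ≤ R s)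
    (Hb : ∀ s, s ≤ K → ∀ d' : ℕ,
      (C.Eb + C.μ + (3 * C.E₂ * (L : ℝ) ^ C.q' + C.E₃ * (L : ℝ) ^ C.q' + 3 * C.κ₁) * (R s : ℝ) ^ (C.q' + 1)) *
          ((d' : ℝ) + 1) + 2 * p0Profile C.A₀ C.p₀ (g s) ≤
        C.a * (p0Profile C.A₀ C.p₀ (g s)) ^ 2 * ((d' : ℝ) + 1) + 2 * p0Profile C.A₀ C.p₀ (g s))
    (b : ε) (j : ℕ) (hc : ConsistentTH sh C K R D (Gen.born b j)) :
    ∑ n ∈ Finset.Ico j (j + padW (dictWT sh R C.n₁) D b), costT sh C K R (Gen.born b j) n +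
      (C.κ₁ * ((bankW sh R C.n₁ D b : ℕ) : ℝ) + Emarg C (sh b)) + reserve C g (sh b) ≤ credit C g (sh b) := by
  have hk : (sh b).kind = 0 := by simp only [ConsistentTH] at hc; exact hc.1
  have hcT : ConsistentT sh C K R (Gen.born b j) := by
    simp only [ConsistentTH] at hc; simp only [ConsistentT]; exact hc
  have h := bornT_holds hC h29 hL hR1 Hb b j hcT
  have hsplit : ∑ n ∈ Finset.Ico j (j + padW (dictWT sh R C.n₁) D b), costT sh C K R (Gen.born b j) n =
      ∑ n ∈ Finset.Ico j (j + dictWT sh R C.n₁ b), costT sh C K R (Gen.born b j) n := by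
    symm
    apply Finset.sum_subset
    · intro n hn
      rw [Finset.mem_Ico] at hn ⊢
      rw [padW_apply]
      omega
    · intro n hn hn'
      rw [Finset.mem_Ico] at hn'
      apply ConsistentT.cost_eq_zero hC.dC_le hcT
      rw [mem_life, Gen.rootStep_born, Gen.reach_born]
      exact hn'
  rw [hsplit, bankW_kind0 hk]
  exact h

/-- **RENEWAL, PAST** (exact): before its window opens the renewed component books exactly the old component's costs —
`renewT_past_eq` by name (the renewed structure is `ConsistentT`: renewals act by the horizon). [folklore] -/
theorem renewTH_past_eq (G : Gen ε) (e : ε) (h : ℕ) (hc : ConsistentTH sh C K R D (Gen.renew G e h))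
    (hW : (Gen.renew G e h).WF (padW (dictWT sh R C.n₁) D)) (n : ℕ) (hn : n ≤ h) :
    costT sh C K R (Gen.renew G e h) n = costT sh C K R G n :=
  renewT_past_eq G e h (ConsistentTH.renew_consistentT hc)
    (wf_of_consistentT_freshT (ConsistentTH.renew_consistentT hc) (FreshT.of_wf _ hW)) n hn

/-- **RENEWAL**: over the padded window `[h + 1, h + 1 + W e + D)` the renewed component books exactly what it books over
its true window (its cost vanishes from its true reach on), its bank is its true window — `renewT_holds` by name.
[folklore] -/
theorem renewTH_holds (hC : C.Valid) (h29 : B14FlowStep.FlowIneq29 R g L β' β₀ K) (hL : 1 ≤ L)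
    (hR1 : ∀ s, s ≤ K → 1 ≤ R s)
    (Hr : ∀ h, h + 1 ≤ K →
      2 * C.E₂ * (L : ℝ) ^ C.q' * (R (h + 1) : ℝ) ^ (C.q' + 1) + (C.κ₁ * ((R (h + 1) : ℝ) + 1) + C.E₀) ≤
        p0Profile C.A₀ C.p₀ (g h))
    (G : Gen ε) (e : ε) (h : ℕ) (hc : ConsistentTH sh C K R D (Gen.renew G e h))
    (hW : (Gen.renew G e h).WF (padW (dictWT sh R C.n₁) D)) :
    ∑ n ∈ Finset.Ico (h + 1) (h + 1 + padW (dictWT sh R C.n₁) D e), costT sh C K R (Gen.renew G e h) n +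
      (C.κ₁ * ((bankW sh R C.n₁ D e : ℕ) : ℝ) + Emarg C (sh e)) ≤ credit C g (sh e) := by
  have hcT := ConsistentTH.renew_consistentT hc
  have hWT := wf_of_consistentT_freshT hcT (FreshT.of_wf _ hW)
  have hk : (sh e).kind = 1 := by simp only [ConsistentTH] at hc; exact hc.2.1
  have h0 := renewT_holds hC h29 hL hR1 Hr G e h hcT hWT
  have hsplit : ∑ n ∈ Finset.Ico (h + 1) (h + 1 + padW (dictWT sh R C.n₁) D e), costT sh C K R (Gen.renew G e h) n =
      ∑ n ∈ Finset.Ico (h + 1) (h + 1 + dictWT sh R C.n₁ e), costT sh C K R (Gen.renew G e h) n := by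
    symm
    apply Finset.sum_subset
    · intro n hn
      rw [Finset.mem_Ico] at hn ⊢
      rw [padW_apply]
      omega
    · intro n hn hn'
      rw [Finset.mem_Ico] at hn hn'
      apply ConsistentT.cost_eq_zero hC.dC_le hcT
      rw [mem_life, Gen.rootStep_renew, Gen.reach_renew]
      omega
  rw [hsplit, bankW_kind1 hk]
  exact h0

/-- **MERGER, GEOMETRY — EXACT over the padded lives**: the merged structure's padded-life cost is the two partners'
padded-life costs plus the (true) extension — additivity over the disjoint label sets; each partner's cost lives on
`[rootStep, reach + D) ⊆` its padded life `⊆` the merged padded life; the merger's true window `[M, M + W e)` and the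
connector epoch lie inside the merged padded life because an overdue partner has `reach + D > t`. [folklore] -/
theorem lifeCostTH_merge_eq (hC : C.Valid) (X Y : Gen ε) (e : ε) (hc : ConsistentTH sh C K R D (Gen.merge X Y e))
    (hW : (Gen.merge X Y e).WF (padW (dictWT sh R C.n₁) D)) :
    lifeCost (padW (dictWT sh R C.n₁) D) (costT sh C K R) (Gen.merge X Y e) =
      lifeCost (padW (dictWT sh R C.n₁) D) (costT sh C K R) X +
        lifeCost (padW (dictWT sh R C.n₁) D) (costT sh C K R) Y + extnT sh C K R X Y e := by
  have hc' := hc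
  simp only [ConsistentTH] at hc'
  obtain ⟨hX, hY, -, hx, hx', hy, hy', htK⟩ := hc'
  have hW' := hW
  simp only [Gen.WF] at hW'
  obtain ⟨-, -, heX, heY, hXY, -, -⟩ := hW'
  have hrX := ConsistentTH.rootStep_le_reach hX
  have hrY := ConsistentTH.rootStep_le_reach hY
  have hpX := reach_add_le_reach_padW (dictWT sh R C.n₁) D X
  have hpY := reach_add_le_reach_padW (dictWT sh R C.n₁) D Y
  have hwin := ConsistentTH.event_window hC.dC_le hc e (by simp)
  simp only [Gen.rootStep_merge, Gen.reach_merge] at hwin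
  have hLX : life (padW (dictWT sh R C.n₁) D) X ⊆ life (padW (dictWT sh R C.n₁) D) (Gen.merge X Y e) :=
    fun n hn => by
      rw [mem_life] at hn ⊢
      rw [Gen.rootStep_merge, Gen.reach_merge, padW_apply]
      constructor <;> omega
  have hLY : life (padW (dictWT sh R C.n₁) D) Y ⊆ life (padW (dictWT sh R C.n₁) D) (Gen.merge X Y e) :=
    fun n hn => by
      rw [mem_life] at hn ⊢
      rw [Gen.rootStep_merge, Gen.reach_merge, padW_apply]
      constructor <;> omega
  have hLM : Finset.Ico (max (X.reach (dictWT sh R C.n₁)) (Y.reach (dictWT sh R C.n₁)))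
      (max (X.reach (dictWT sh R C.n₁)) (Y.reach (dictWT sh R C.n₁)) + dictWT sh R C.n₁ e) ⊆
        life (padW (dictWT sh R C.n₁) D) (Gen.merge X Y e) := fun n hn => by
    rw [Finset.mem_Ico] at hn
    rw [mem_life, Gen.rootStep_merge, Gen.reach_merge, padW_apply]
    constructor <;> omega
  have hLS : ∀ n ∈ supp C (sh e), n ∈ life (padW (dictWT sh R C.n₁) D) (Gen.merge X Y e) := fun n hn => by
    simp only [supp, Finset.mem_Ioc] at hn
    rw [mem_life, Gen.rootStep_merge, Gen.reach_merge, padW_apply]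
    constructor <;> omega
  have hsumX : ∑ n ∈ life (padW (dictWT sh R C.n₁) D) (Gen.merge X Y e), costT sh C K R X n =
      ∑ n ∈ life (padW (dictWT sh R C.n₁) D) X, costT sh C K R X n :=
    (Finset.sum_subset hLX fun n _ hn => ConsistentTH.cost_eq_zero_of_not_mem_life hC.dC_le hX hn).symm
  have hsumY : ∑ n ∈ life (padW (dictWT sh R C.n₁) D) (Gen.merge X Y e), costT sh C K R Y n =
      ∑ n ∈ life (padW (dictWT sh R C.n₁) D) Y, costT sh C K R Y n :=
    (Finset.sum_subset hLY fun n _ hn => ConsistentTH.cost_eq_zero_of_not_mem_life hC.dC_le hY hn).symm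
  have hsumS : ∑ n ∈ life (padW (dictWT sh R C.n₁) D) (Gen.merge X Y e), sz C K R (sh e) n =
      ∑ n ∈ supp C (sh e), sz C K R (sh e) n :=
    (Finset.sum_subset (fun n hn => hLS n hn) fun n _ hn => sz_eq_zero_of_not_mem hn).symm
  unfold lifeCost extnT
  rw [Finset.sum_congr rfl fun n _ => costT_merge_eq heX heY hXY n, Finset.sum_add_distrib, Finset.sum_add_distrib,
    Finset.sum_add_distrib, hsumX, hsumY, sum_wfloor_eq hLM, hsumS]

omit [DecidableEq ε] in
/-- **MERGER, PAY — AT THE ABSORBED ROOT, WITH THE HORIZON IN THE BANK**: the absorbed root's reserve `2p₀(g_m)` pays the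
(true) extension and the merger-padded bank `κ₁(n₁ + R_t + D) + E₀`, given `HmH` at the absorbed root index `m ≤ K`
(`R_t ≤ L·R_m` by (2.9) when `m < t`, by `L ≥ 1` when `m = t`; the floor over the merger window sits at steps `≥ m`).
[folklore] -/
theorem mergeTH_pay_holds (hC : C.Valid) (h29 : B14FlowStep.FlowIneq29 R g L β' β₀ K) (hL : 1 ≤ L)
    (hR1 : ∀ s, s ≤ K → 1 ≤ R s)
    (HmH : ∀ m, m ≤ K →
      (((C.n₁ : ℝ) + L) * C.E₂ * (L : ℝ) ^ C.q' + C.dC * C.E₃ * (L : ℝ) ^ C.q' * (L : ℝ) ^ C.q') *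
            (R m : ℝ) ^ (C.q' + 1) +
          (C.κ₁ * ((C.n₁ : ℝ) + D + L * R m) + C.E₀) ≤ 2 * p0Profile C.A₀ C.p₀ (g m))
    (X Y : Gen ε) (e : ε) (hc : ConsistentTH sh C K R D (Gen.merge X Y e)) :
    extnT sh C K R X Y e + (C.κ₁ * ((bankW sh R C.n₁ D e : ℕ) : ℝ) + Emarg C (sh e)) ≤
      reserve C g (sh (absorbed X Y)) + credit C g (sh e) := by
  have hab := ConsistentTH.absorbed_spec hc
  have hc' := hc
  simp only [ConsistentTH] at hc'
  obtain ⟨-, -, hk, -, -, -, -, htK⟩ := hc'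
  have hmK : (sh (absorbed X Y)).step ≤ K := hab.2.1.trans htK
  have hWn : dictWT sh R C.n₁ e = C.n₁ + R (sh e).step := dictW_kind2 hk
  unfold extnT
  rw [credit_kind2 hk, Emarg_kind2 hk, reserve_kind0 hab.1, bankW_kind2 hk, hWn]
  have hfl : ∑ n ∈ Finset.Ico (max (X.reach (dictWT sh R C.n₁)) (Y.reach (dictWT sh R C.n₁)))
        (max (X.reach (dictWT sh R C.n₁)) (Y.reach (dictWT sh R C.n₁)) + (C.n₁ + R (sh e).step)), floorK C K R n ≤
      ((C.n₁ + R (sh e).step : ℕ) : ℝ) * (C.E₂ * ((L : ℝ) * R (sh (absorbed X Y)).step) ^ C.q') := by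
    have h := sum_floorK_le h29 hL hC.E₂_nonneg (s := (sh (absorbed X Y)).step)
      (T := Finset.Ico (max (X.reach (dictWT sh R C.n₁)) (Y.reach (dictWT sh R C.n₁)))
        (max (X.reach (dictWT sh R C.n₁)) (Y.reach (dictWT sh R C.n₁)) + (C.n₁ + R (sh e).step)))
      (fun n hn => le_trans hab.2.2 (Finset.mem_Ico.1 hn).1)
    rwa [Nat.card_Ico, Nat.add_sub_cancel_left] at h
  have hszs : ∑ n ∈ supp C (sh e), sz C K R (sh e) n ≤ C.E₃ * ((L : ℝ) * R (sh e).step) ^ C.q' * C.dC := by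
    have h := sum_supp_sz_le h29 hC.E₃_nonneg (sh e)
    rwa [wt_kind2 hk] at h
  push_cast at hfl
  have hP : (1 : ℝ) ≤ R (sh (absorbed X Y)).step := by exact_mod_cast hR1 _ hmK
  have hLr : (1 : ℝ) ≤ L := by exact_mod_cast hL
  have hQ : (R (sh e).step : ℝ) ≤ L * R (sh (absorbed X Y)).step := by
    rcases hab.2.1.eq_or_lt with hmt | hmt
    · rw [← hmt]
      have h0 : (0 : ℝ) ≤ R (sh (absorbed X Y)).step := Nat.cast_nonneg _
      nlinarith
    · exact (h29 _ _ hmt htK).1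
  have key := mergeH_arith (Dr := (D : ℝ)) (E₀ := C.E₀) hP (Nat.cast_nonneg _) hQ hLr hC.E₂_nonneg hC.E₃_nonneg
    (Nat.cast_nonneg C.n₁) (Nat.cast_nonneg C.dC) hC.κ₁_nonneg C.q'
  have hpay := HmH (sh (absorbed X Y)).step hmK
  push_cast
  linarith

/-- **THE LATE-MERGER DATA INHABIT `Banking`** — admissibility `ConsistentTH sh C K R D`, windows `padW (dictWT sh R C.n₁)
D` (life geometry), cost `costT`, credit / reserve at the shape, bank `κ₁·bankW + Emarg`, extension `extnT`: all four
binders of `T4BankedInduction.Banking`, the merger geometry EXACTLY, given (2.9), `1 ≤ R s`, the birth and renewal pay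
inequalities `Hb`, `Hr` of `T4TaggedShapeBanking` VERBATIM and the merger pay inequality `HmH` (horizon in the bank,
absorbed-root index). [folklore] -/
theorem banking_lateMergers (hC : C.Valid) (h29 : B14FlowStep.FlowIneq29 R g L β' β₀ K) (hL : 1 ≤ L)
    (hR1 : ∀ s, s ≤ K → 1 ≤ R s)
    (Hb : ∀ s, s ≤ K → ∀ d' : ℕ,
      (C.Eb + C.μ + (3 * C.E₂ * (L : ℝ) ^ C.q' + C.E₃ * (L : ℝ) ^ C.q' + 3 * C.κ₁) * (R s : ℝ) ^ (C.q' + 1)) *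
          ((d' : ℝ) + 1) + 2 * p0Profile C.A₀ C.p₀ (g s) ≤
        C.a * (p0Profile C.A₀ C.p₀ (g s)) ^ 2 * ((d' : ℝ) + 1) + 2 * p0Profile C.A₀ C.p₀ (g s))
    (Hr : ∀ h, h + 1 ≤ K →
      2 * C.E₂ * (L : ℝ) ^ C.q' * (R (h + 1) : ℝ) ^ (C.q' + 1) + (C.κ₁ * ((R (h + 1) : ℝ) + 1) + C.E₀) ≤
        p0Profile C.A₀ C.p₀ (g h))
    (HmH : ∀ m, m ≤ K →
      (((C.n₁ : ℝ) + L) * C.E₂ * (L : ℝ) ^ C.q' + C.dC * C.E₃ * (L : ℝ) ^ C.q' * (L : ℝ) ^ C.q') *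
            (R m : ℝ) ^ (C.q' + 1) +
          (C.κ₁ * ((C.n₁ : ℝ) + D + L * R m) + C.E₀) ≤ 2 * p0Profile C.A₀ C.p₀ (g m)) :
    Banking (ConsistentTH sh C K R D) (padW (dictWT sh R C.n₁) D) (costT sh C K R) (credit C g ∘ sh)
      (fun e => C.κ₁ * ((bankW sh R C.n₁ D e : ℕ) : ℝ) + Emarg C (sh e)) (reserve C g ∘ sh) (extnT sh C K R) where
  cost_nonneg := costT_nonneg hC.E₂_nonneg hC.E₃_nonneg
  adm_renew G e h hc := by
    simp only [ConsistentTH] at hc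
    exact hc.1
  adm_merge X Y e hc := by
    simp only [ConsistentTH] at hc
    exact ⟨hc.1, hc.2.1⟩
  born b j hc := bornTH_holds hC h29 hL hR1 Hb b j hc
  renew_past G e h hc hW n hn := (renewTH_past_eq G e h hc hW n hn).le
  renew G e h hc hW := renewTH_holds hC h29 hL hR1 Hr G e h hc hW
  merge_geom X Y e hc hW := (lifeCostTH_merge_eq hC X Y e hc hW).le
  merge_pay X Y e hc _ := mergeTH_pay_holds hC h29 hL hR1 HmH X Y e hc

end InhabitTH

/-! ## §8 The merger pay inequality with horizon from the typed flow; one threshold for the late-merger banking -/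

section PayH

variable {C : T4PrintedShapeBanking.Consts} {K L r : ℕ} {R : ℕ → ℕ} {g : ℕ → ℝ} {β' β₀ : ℝ}

/-- **THE MERGER PAY INEQUALITY WITH HORIZON FROM THE TYPED FLOW** — `T4BankedInduction.mergeSurplus_pays` with the
window profile `W s := n₁ + D + L·R_s ≤ (n₁ + D + L)·R_s`, `E₁ := (n₁ + L)E₂L^{q′} + dC·E₃·L^{q′}L^{q′}`, at `m = s`:
given typed (2.7) / (2.5), the two γ-clauses at the infrared value and `(1+β₀)(c₃+c₄) ≤ 2`. [folklore] -/
theorem mergePayH_of_flow {c₃ c₄ : ℝ} (hC : C.Valid) (hA : 0 ≤ C.A₀) (h27 : B14.FlowIneq27 g β' β₀ C.p₀ K)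
    (hR : ∀ s, s ≤ K → B14.IsRj L r (g s) (R s)) (hrp : r ≤ C.p₀) (hrq : r * (C.q' + 1) ≤ C.p₀) (hL : 1 ≤ L)
    (hβ : 0 ≤ β₀) (hc₃ : 0 ≤ c₃) (hc₄ : 0 ≤ c₄) (hx1 : ∀ s, s ≤ K → 1 ≤ Real.log ((g s) ^ 2)⁻¹) (D : ℕ)
    (hγ₃ : (L : ℝ) * (1 + β₀) * ((1 + (((C.n₁ : ℝ) + D + L) - 1)) * C.κ₁ + C.E₀) ≤
      c₃ * C.A₀ * (Real.log ((g K) ^ 2)⁻¹) ^ (C.p₀ - r))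
    (hγ₄ : (L : ℝ) ^ (C.q' + 1) * (1 + β₀) *
        (((C.n₁ : ℝ) + L) * C.E₂ * (L : ℝ) ^ C.q' + C.dC * C.E₃ * (L : ℝ) ^ C.q' * (L : ℝ) ^ C.q') ≤
      c₄ * C.A₀ * (Real.log ((g K) ^ 2)⁻¹) ^ (C.p₀ - r * (C.q' + 1)))
    (hb₂ : (1 + β₀) * (c₃ + c₄) ≤ 2) :
    ∀ m, m ≤ K →
      (((C.n₁ : ℝ) + L) * C.E₂ * (L : ℝ) ^ C.q' + C.dC * C.E₃ * (L : ℝ) ^ C.q' * (L : ℝ) ^ C.q') *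
            (R m : ℝ) ^ (C.q' + 1) +
          (C.κ₁ * ((C.n₁ : ℝ) + D + L * R m) + C.E₀) ≤ 2 * p0Profile C.A₀ C.p₀ (g m) := by
  have hR1 := one_le_R hR hL
  have hW : ∀ s, s ≤ K → (((fun s => C.n₁ + D + L * R s) s : ℕ) : ℝ) ≤ (1 + (((C.n₁ : ℝ) + D + L) - 1)) * R s := by
    intro s hs
    have h1 : (1 : ℝ) ≤ R s := by exact_mod_cast hR1 s hs
    have hn : (0 : ℝ) ≤ C.n₁ := Nat.cast_nonneg _
    have hD : (0 : ℝ) ≤ D := Nat.cast_nonneg _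
    push_cast
    nlinarith
  have h := mergeSurplus_pays (W := fun s => C.n₁ + D + L * R s) (F := ((C.n₁ : ℝ) + D + L) - 1)
    (E₁ := ((C.n₁ : ℝ) + L) * C.E₂ * (L : ℝ) ^ C.q' + C.dC * C.E₃ * (L : ℝ) ^ C.q' * (L : ℝ) ^ C.q')
    (q := C.q' + 1) h27 hR hrp hrq hL hβ hA hc₃ hc₄ hC.E₀_nonneg hC.κ₁_nonneg hx1 hW hγ₃ hγ₄ hb₂
  intro m hm
  have := h m m le_rfl hm
  push_cast at this
  linarith

/-- **ONE INFRARED THRESHOLD FOR THE LATE-MERGER PAY SIDE, constants and `D` only**: for valid symbolic constants with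
`a, A₀ > 0`, `L ≥ 1`, `β₀ ≥ 0`, `r(q′+1) < p₀` and a horizon `D` there is `x₀` such that along EVERY run of the typed flow
((2.7), (2.5), `1 ≤ log g_s⁻²`) with `x₀ ≤ log g_K⁻²` the birth and renewal pay inequalities of
`T4TaggedShapeBanking.exists_payThreshold` AND the merger pay inequality with horizon hold.  `x₀` depends on `D` (a
constant), NOT on `K`. [folklore] -/
theorem exists_payThresholdH (C : T4PrintedShapeBanking.Consts) (hC : C.Valid) (ha : 0 < C.a) (hA : 0 < C.A₀)
    {L r : ℕ} (hL : 1 ≤ L) {β₀ : ℝ} (hβ : 0 ≤ β₀) (hrq : r * (C.q' + 1) < C.p₀) (D : ℕ) :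
    ∃ x₀ : ℝ, ∀ (K : ℕ) (R : ℕ → ℕ) (g : ℕ → ℝ) (β' : ℝ),
      B14.FlowIneq27 g β' β₀ C.p₀ K → (∀ s, s ≤ K → B14.IsRj L r (g s) (R s)) →
      (∀ s, s ≤ K → 1 ≤ Real.log ((g s) ^ 2)⁻¹) → x₀ ≤ Real.log ((g K) ^ 2)⁻¹ →
      (∀ s, s ≤ K → ∀ d' : ℕ,
        (C.Eb + C.μ + (3 * C.E₂ * (L : ℝ) ^ C.q' + C.E₃ * (L : ℝ) ^ C.q' + 3 * C.κ₁) * (R s : ℝ) ^ (C.q' + 1)) *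
            ((d' : ℝ) + 1) + 2 * p0Profile C.A₀ C.p₀ (g s) ≤
          C.a * (p0Profile C.A₀ C.p₀ (g s)) ^ 2 * ((d' : ℝ) + 1) + 2 * p0Profile C.A₀ C.p₀ (g s)) ∧
      (∀ h, h + 1 ≤ K →
        2 * C.E₂ * (L : ℝ) ^ C.q' * (R (h + 1) : ℝ) ^ (C.q' + 1) + (C.κ₁ * ((R (h + 1) : ℝ) + 1) + C.E₀) ≤
          p0Profile C.A₀ C.p₀ (g h)) ∧
      (∀ m, m ≤ K →
        (((C.n₁ : ℝ) + L) * C.E₂ * (L : ℝ) ^ C.q' + C.dC * C.E₃ * (L : ℝ) ^ C.q' * (L : ℝ) ^ C.q') *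
              (R m : ℝ) ^ (C.q' + 1) +
            (C.κ₁ * ((C.n₁ : ℝ) + D + L * R m) + C.E₀) ≤ 2 * p0Profile C.A₀ C.p₀ (g m)) := by
  have hrp : r < C.p₀ := lt_of_le_of_lt (Nat.le_mul_of_pos_right r (Nat.succ_pos _)) hrq
  have hb0 : (0 : ℝ) < 1 + β₀ := by linarith
  have hcM : 0 < 1 / (1 + β₀) * C.A₀ := by positivity
  obtain ⟨x₁, hx₁⟩ := exists_payThreshold C hC ha hA hL hβ hrq
  obtain ⟨x₂, hx₂⟩ := exists_threshold_poly (β₀ := β₀) (F := ((C.n₁ : ℝ) + D + L) - 1) (E₀ := C.E₀)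
    (E₁ := ((C.n₁ : ℝ) + L) * C.E₂ * (L : ℝ) ^ C.q' + C.dC * C.E₃ * (L : ℝ) ^ C.q' * (L : ℝ) ^ C.q') (κ₁ := C.κ₁)
    (L := L) (q := C.q' + 1) hrp hrq hcM hcM
  refine ⟨max x₁ x₂, fun K R g β' h27 hR hx1 hxK => ?_⟩
  obtain ⟨Hb, Hr, -⟩ := hx₁ K R g β' h27 hR hx1 ((le_max_left _ _).trans hxK)
  obtain ⟨hγ₃, hγ₄⟩ := hx₂ _ ((le_max_right _ _).trans hxK)
  have hb₂ : (1 + β₀) * (1 / (1 + β₀) + 1 / (1 + β₀)) ≤ 2 := by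
    rw [show (1 + β₀) * (1 / (1 + β₀) + 1 / (1 + β₀)) = 2 by field_simp; ring]
  exact ⟨Hb, Hr, mergePayH_of_flow hC hA.le h27 hR hrp.le hrq.le hL hβ (by positivity) (by positivity) hx1 D hγ₃ hγ₄
    hb₂⟩

variable {ε : Type*} [DecidableEq ε]

/-- **ONE INFRARED THRESHOLD, EVERY CUTOFF, EVERY LABEL TYPE — LATE MERGERS ADMITTED**: for valid symbolic constants
with `a, A₀ > 0`, `L ≥ 1`, `β₀ ≥ 0`, `r(q′+1) < p₀` and a horizon `D` there is `x₀` (constants and `D` only) such that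
along EVERY run of the typed flow ((2.7), (2.9), (2.5), `1 ≤ log g_s⁻²`) with `x₀ ≤ log g_K⁻²` the late-merger data of
EVERY shape map `sh : ε → PEv` inhabit `Banking (ConsistentTH sh C K R D) (padW (dictWT sh R C.n₁) D) …`. [folklore] -/
theorem exists_irThresholdTH (sh : ε → PEv) (C : T4PrintedShapeBanking.Consts) (hC : C.Valid) (ha : 0 < C.a)
    (hA : 0 < C.A₀) {L r : ℕ} (hL : 1 ≤ L) {β₀ : ℝ} (hβ : 0 ≤ β₀) (hrq : r * (C.q' + 1) < C.p₀) (D : ℕ) :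
    ∃ x₀ : ℝ, ∀ (K : ℕ) (R : ℕ → ℕ) (g : ℕ → ℝ) (β' : ℝ),
      B14.FlowIneq27 g β' β₀ C.p₀ K → B14FlowStep.FlowIneq29 R g L β' β₀ K →
      (∀ s, s ≤ K → B14.IsRj L r (g s) (R s)) → (∀ s, s ≤ K → 1 ≤ Real.log ((g s) ^ 2)⁻¹) →
      x₀ ≤ Real.log ((g K) ^ 2)⁻¹ →
        Banking (ConsistentTH sh C K R D) (padW (dictWT sh R C.n₁) D) (costT sh C K R) (credit C g ∘ sh)
          (fun e => C.κ₁ * ((bankW sh R C.n₁ D e : ℕ) : ℝ) + Emarg C (sh e)) (reserve C g ∘ sh) (extnT sh C K R) := by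
  obtain ⟨x₀, hx₀⟩ := exists_payThresholdH C hC ha hA hL hβ hrq D
  refine ⟨x₀, fun K R g β' h27 h29 hR hx1 hxK => ?_⟩
  obtain ⟨Hb, Hr, Hm⟩ := hx₀ K R g β' h27 hR hx1 hxK
  exact banking_lateMergers hC h29 hL (one_le_R hR hL) Hb Hr Hm

end PayH

end

end Summit.QuantumFields.BalabanUV.T4Continuum.LateMergers
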